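import Literature.MathematicalPhysics.QuantumFieldTheory.YangMillsOS

/-!
# Geometry / bookkeeping for stub `stub_speciesClustering` (crux stmt-QuantumFields-8761, line `Sketch`)

Support lemmas (no definitions) for the assembly
`Summit.QuantumFields.YangMills.Theorems.LatticeGapLargeBeta.WittenIMS.stub_speciesClustering`
on the torus `(ℤ/(2S+1))⁴` (time = axis `0`):

* `le_val_sub_and_of_int` / `sep_of_time_ranges` — cyclic separation of two time windows in `ZMod (2S+1)`,
  written as casts of ONE integer in `[0, N)` (`ZMod.val_intCast`, `Int.emod_eq_of_lt`);
* `exists_collar` — for every finite link set `Λ` a collar `T`, disjoint from `Λ`, containing every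
  plaquette that meets `Λ`, of cardinality `≤ 64 |Λ|`, every edge of which is at time distance `≤ 1`
  from an edge of `Λ`;
* `exists_time_of_mem_image`, `exists_time_of_union` — time windows of the projected shifted support of a
  local observable and of its collar.
-/

noncomputable section

open Literature.MathematicalPhysics.QuantumFieldTheory Literature.MathematicalPhysics.QuantumLattice
open Literature.Probability.LatticeModels (Torus.proj Torus.proj_apply)

namespace Summit.QuantumFields.YangMills.Theorems.LatticeGapLargeBeta.WittenIMS

/-! ## `ZMod` bookkeeping -/

/-- Two residues given as casts of integers `a < b < a + N`: the cyclic differences are `b - a` and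
`N - (b - a)`, so both are `≥ k` once `k ≤ b - a ≤ N - k`, and the residues differ (registered sub-goal
of stmt-QuantumFields-8761; the statement is kept on one line, verbatim as registered). -/
theorem le_val_sub_and_of_int : ∀ {N : ℕ} [NeZero N] {a b : ℤ} {k : ℕ}, (k : ℤ) ≤ b - a → 0 < b - a → b - a < (N : ℤ) → (k : ℤ) ≤ (N : ℤ) - (b - a) → k ≤ ZMod.val (((b : ℤ) : ZMod N) - ((a : ℤ) : ZMod N)) ∧ k ≤ ZMod.val (((a : ℤ) : ZMod N) - ((b : ℤ) : ZMod N)) ∧ ((a : ℤ) : ZMod N) ≠ ((b : ℤ) : ZMod N) := by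
  -- adapted from `LatticeGapInUVUnits.FemtoSlabNondegeneracy.DecayToClustering.val_sub_neg_lt`
  intro N _ a b k hk hab hN hk'
  have e1 : ((b : ℤ) : ZMod N) - ((a : ℤ) : ZMod N) = ((b - a : ℤ) : ZMod N) := by push_cast; ring
  have e2 : ((a : ℤ) : ZMod N) - ((b : ℤ) : ZMod N) = ((a - b + N : ℤ) : ZMod N) := by
    push_cast; rw [ZMod.natCast_self, add_zero]
  have h1 := ZMod.val_intCast (n := N) (b - a)
  rw [Int.emod_eq_of_lt hab.le hN] at h1
  have h2 := ZMod.val_intCast (n := N) (a - b + N)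
  rw [Int.emod_eq_of_lt (by omega) (by omega)] at h2
  refine ⟨?_, ?_, fun h => ?_⟩
  · rw [e1]; omega
  · rw [e2]; omega
  · have h0 : (((b : ℤ) : ZMod N) - ((a : ℤ) : ZMod N)).val = 0 := by rw [h, sub_self, ZMod.val_zero]
    rw [e1] at h0
    omega

/-- **Cyclic separation of two time windows.** On `ZMod (2S+1)`, a time `a ∈ [-p, p]` and a time
`b ∈ [n - q, n + q]` are at cyclic distance `≥ k` in both directions (and differ) as soon as
`p + q + k ≤ n`, `p + q + 1 ≤ n`, `n + p + q ≤ 2S` and `k + n + p + q ≤ 2S + 1`. -/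
theorem sep_of_time_ranges {S p q n k : ℕ} (h1 : p + q + k ≤ n) (h1' : p + q + 1 ≤ n)
    (h2 : n + p + q ≤ 2 * S) (h2' : k + n + p + q ≤ 2 * S + 1) {a b : ℤ}
    (ha1 : -(p : ℤ) ≤ a) (ha2 : a ≤ p) (hb1 : (n : ℤ) - q ≤ b) (hb2 : b ≤ n + q) :
    k ≤ (((b : ℤ) : ZMod (2 * S + 1)) - ((a : ℤ) : ZMod (2 * S + 1))).val ∧
      k ≤ (((a : ℤ) : ZMod (2 * S + 1)) - ((b : ℤ) : ZMod (2 * S + 1))).val ∧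
      ((a : ℤ) : ZMod (2 * S + 1)) ≠ ((b : ℤ) : ZMod (2 * S + 1)) :=
  le_val_sub_and_of_int (by omega) (by omega) (by push_cast; omega) (by push_cast; omega)

/-! ## Plaquette collars -/

/-- **Collars.** Every finite link set `Λ` of the torus has a collar `T`: disjoint from `Λ`, every
plaquette meeting `Λ` has all its edges in `Λ ∪ T`, `|T| ≤ 64 |Λ|`, and every edge of `T` is at time
distance `≤ 1` from some edge of `Λ` (the plaquettes through an edge `(x, l)` are parametrised by a
second direction `d` and two bits; a plaquette based at `y` has its edges at times `y 0`, `y 0 + 1`). -/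
theorem exists_collar {N : ℕ} (Λ : Finset (Edge 4 N)) :
    ∃ T : Finset (Edge 4 N), Disjoint Λ T ∧
      (∀ (y : Site 4 N) (i j : Fin 4), i < j →
        (({(y, i), (y.shift i, j), (y.shift j, i), (y, j)} : Finset (Edge 4 N)) ∩ Λ).Nonempty →
        (↑({(y, i), (y.shift i, j), (y.shift j, i), (y, j)} : Finset (Edge 4 N)) : Set (Edge 4 N)) ⊆
          ↑Λ ∪ ↑T) ∧
      T.card ≤ 64 * Λ.card ∧
      ∀ e' ∈ T, ∃ e ∈ Λ, e'.1 0 = e.1 0 ∨ e'.1 0 = e.1 0 + 1 ∨ e'.1 0 + 1 = e.1 0 := by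
  classical
  -- the plaquette through `e` with parameters `p = (useShift, swap, d)`
  let base : Edge 4 N → Bool × Bool × Fin 4 → Site 4 N := fun e p =>
    if p.1 then e.1 - Pi.single p.2.2 1 else e.1
  let d1 : Edge 4 N → Bool × Bool × Fin 4 → Fin 4 := fun e p => if p.2.1 then p.2.2 else e.2
  let d2 : Edge 4 N → Bool × Bool × Fin 4 → Fin 4 := fun e p => if p.2.1 then e.2 else p.2.2
  let P : Edge 4 N → Bool × Bool × Fin 4 → Finset (Edge 4 N) := fun e p =>
    {(base e p, d1 e p), ((base e p).shift (d1 e p), d2 e p), ((base e p).shift (d2 e p), d1 e p),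
      (base e p, d2 e p)}
  -- every plaquette through `e` is some `P e p`
  have hP : ∀ (y : Site 4 N) (i j : Fin 4) (e : Edge 4 N),
      e ∈ ({(y, i), (y.shift i, j), (y.shift j, i), (y, j)} : Finset (Edge 4 N)) →
      ∃ p, P e p = {(y, i), (y.shift i, j), (y.shift j, i), (y, j)} := by
    intro y i j e he
    simp only [Finset.mem_insert, Finset.mem_singleton] at he
    rcases he with rfl | rfl | rfl | rfl
    · exact ⟨(false, false, j), by simp [P, base, d1, d2]⟩
    · exact ⟨(true, true, i), by simp [P, base, d1, d2, Site.shift]⟩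
    · exact ⟨(true, false, j), by simp [P, base, d1, d2, Site.shift]⟩
    · exact ⟨(false, true, i), by simp [P, base, d1, d2]⟩
  -- time offsets
  have hbase : ∀ (e : Edge 4 N) (p : Bool × Bool × Fin 4),
      ∃ δ : ZMod N, (δ = 0 ∨ δ = 1) ∧ base e p 0 = e.1 0 - δ := by
    rintro e ⟨u, s, d⟩
    cases u
    · exact ⟨0, Or.inl rfl, by simp [base]⟩
    · refine ⟨(Pi.single d 1 : Site 4 N) 0, ?_, by simp [base]⟩
      by_cases h : (0 : Fin 4) = d
      · subst h; simp
      · exact Or.inl (Pi.single_eq_of_ne h _)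
  have hshift : ∀ (x : Site 4 N) (l : Fin 4), ∃ δ : ZMod N, (δ = 0 ∨ δ = 1) ∧ x.shift l 0 = x 0 + δ := by
    intro x l
    refine ⟨(Pi.single l 1 : Site 4 N) 0, ?_, by simp [Site.shift]⟩
    by_cases h : (0 : Fin 4) = l
    · subst h; simp
    · exact Or.inl (Pi.single_eq_of_ne h _)
  have hfin : ∀ (t δ₁ δ₂ : ZMod N), (δ₁ = 0 ∨ δ₁ = 1) → (δ₂ = 0 ∨ δ₂ = 1) →
      t - δ₂ + δ₁ = t ∨ t - δ₂ + δ₁ = t + 1 ∨ t - δ₂ + δ₁ + 1 = t := by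
    rintro t δ₁ δ₂ (rfl | rfl) (rfl | rfl) <;> simp
  have htime : ∀ (e : Edge 4 N) (p : Bool × Bool × Fin 4), ∀ e' ∈ P e p,
      e'.1 0 = e.1 0 ∨ e'.1 0 = e.1 0 + 1 ∨ e'.1 0 + 1 = e.1 0 := by
    intro e p e' he'
    obtain ⟨δ₂, hδ₂, hb⟩ := hbase e p
    simp only [P, Finset.mem_insert, Finset.mem_singleton] at he'
    rcases he' with rfl | rfl | rfl | rfl
    · simpa [hb] using hfin (e.1 0) 0 δ₂ (Or.inl rfl) hδ₂
    · obtain ⟨δ₁, hδ₁, hs⟩ := hshift (base e p) (d1 e p)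
      simpa [hs, hb] using hfin (e.1 0) δ₁ δ₂ hδ₁ hδ₂
    · obtain ⟨δ₁, hδ₁, hs⟩ := hshift (base e p) (d2 e p)
      simpa [hs, hb] using hfin (e.1 0) δ₁ δ₂ hδ₁ hδ₂
    · simpa [hb] using hfin (e.1 0) 0 δ₂ (Or.inl rfl) hδ₂
  refine ⟨(Λ.biUnion fun e => Finset.univ.biUnion (P e)) \ Λ, Finset.disjoint_sdiff, ?_, ?_, ?_⟩
  · intro y i j _ hne e' he'
    obtain ⟨e, he⟩ := hne
    rw [Finset.mem_inter] at he
    obtain ⟨p, hp⟩ := hP y i j e he.1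
    by_cases h' : e' ∈ Λ
    · exact Or.inl h'
    · refine Or.inr (Finset.mem_coe.2 (Finset.mem_sdiff.2 ⟨?_, h'⟩))
      exact Finset.mem_biUnion.2 ⟨e, he.2, Finset.mem_biUnion.2 ⟨p, Finset.mem_univ _, hp ▸ he'⟩⟩
  · calc ((Λ.biUnion fun e => Finset.univ.biUnion (P e)) \ Λ).card
          ≤ (Λ.biUnion fun e => Finset.univ.biUnion (P e)).card :=
            Finset.card_le_card Finset.sdiff_subset
      _ ≤ ∑ e ∈ Λ, (Finset.univ.biUnion (P e)).card := Finset.card_biUnion_le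
      _ ≤ ∑ _e ∈ Λ, 64 := Finset.sum_le_sum fun e _ => ?_
      _ = 64 * Λ.card := by rw [Finset.sum_const, smul_eq_mul, mul_comm]
    calc (Finset.univ.biUnion (P e)).card ≤ ∑ p, (P e p).card := Finset.card_biUnion_le
      _ ≤ ∑ _p : Bool × Bool × Fin 4, 4 := Finset.sum_le_sum fun p _ => Finset.card_le_four
      _ = 64 := by simp
  · intro e' he'
    rw [Finset.mem_sdiff, Finset.mem_biUnion] at he'
    obtain ⟨⟨e, he, hmem⟩, -⟩ := he'
    rw [Finset.mem_biUnion] at hmem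
    obtain ⟨p, -, hp⟩ := hmem
    exact ⟨e, he, htime e p e' hp⟩

/-! ## Time windows of shifted supports -/

variable {G : Type} [Group G] [MeasurableSpace G]

/-- The projected shifted support of a local observable whose support lies in the time slab `[-w, w]`
lies in the time window `[v - w, v + w]` (as casts of integers). -/
theorem exists_time_of_mem_image {N : ℕ} (O : YMSpecies G) (v : ℤ) {w : ℕ}
    (hw : ∀ e ∈ O.supp, (e.1 0).natAbs ≤ w) :
    ∀ e' ∈ O.supp.image (fun e => torusEdge N (e.1 + Pi.single 0 v, e.2)),
      ∃ t : ℤ, e'.1 0 = (t : ZMod N) ∧ v - w ≤ t ∧ t ≤ v + w := by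
  intro e' he'
  obtain ⟨e, he, rfl⟩ := Finset.mem_image.1 he'
  have hb := hw e he
  refine ⟨e.1 0 + v, ?_, by omega, by omega⟩
  simp [torusEdge, Torus.proj_apply]

/-- Time window of a link set together with a collar at time distance `≤ 1`. -/
theorem exists_time_of_union {N : ℕ} {Λ T : Finset (Edge 4 N)} {v : ℤ} {w : ℕ}
    (hΛ : ∀ e ∈ Λ, ∃ t : ℤ, e.1 0 = (t : ZMod N) ∧ v - w ≤ t ∧ t ≤ v + w)
    (hT : ∀ e' ∈ T, ∃ e ∈ Λ, e'.1 0 = e.1 0 ∨ e'.1 0 = e.1 0 + 1 ∨ e'.1 0 + 1 = e.1 0) :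
    ∀ e' ∈ Λ ∪ T, ∃ t : ℤ, e'.1 0 = (t : ZMod N) ∧ v - (w + 1 : ℕ) ≤ t ∧ t ≤ v + (w + 1 : ℕ) := by
  intro e' he'
  rcases Finset.mem_union.1 he' with h | h
  · obtain ⟨t, ht, h1, h2⟩ := hΛ e' h
    exact ⟨t, ht, by push_cast; omega, by push_cast; omega⟩
  · obtain ⟨e, he, h3⟩ := hT e' h
    obtain ⟨t, ht, h1, h2⟩ := hΛ e he
    rcases h3 with h3 | h3 | h3
    · exact ⟨t, by rw [h3, ht], by push_cast; omega, by push_cast; omega⟩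
    · exact ⟨t + 1, by rw [h3, ht]; push_cast; ring, by push_cast; omega, by push_cast; omega⟩
    · exact ⟨t - 1, by rw [eq_sub_of_add_eq h3, ht]; push_cast; ring, by push_cast; omega,
        by push_cast; omega⟩

/-- **Separation of the two collared supports.** If every edge of `XA` has time in `[vA - p, vA + p]`,
`vA = 0`, and every edge of `XB` has time in `[vB - q, vB + q]`, `vB = n` (casts of integers, torus of
side `2S+1`), then
under the arithmetic side conditions of `sep_of_time_ranges` the two sets are disjoint and at cyclic time
separation `≥ k` in both directions. -/
theorem sep_of_windows {S p q n k : ℕ} (h1 : p + q + k ≤ n) (h1' : p + q + 1 ≤ n)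
    (h2 : n + p + q ≤ 2 * S) (h2' : k + n + p + q ≤ 2 * S + 1) {vA vB : ℤ} (hvA : vA = 0)
    (hvB : vB = n) {XA XB : Finset (Edge 4 (2 * S + 1))}
    (hA : ∀ e ∈ XA, ∃ t : ℤ, e.1 0 = (t : ZMod (2 * S + 1)) ∧ vA - p ≤ t ∧ t ≤ vA + p)
    (hB : ∀ e ∈ XB, ∃ t : ℤ, e.1 0 = (t : ZMod (2 * S + 1)) ∧ vB - q ≤ t ∧ t ≤ vB + q) :
    ∀ e ∈ XA, ∀ e' ∈ XB, e ≠ e' ∧ k ≤ (e.1 0 - e'.1 0).val ∧ k ≤ (e'.1 0 - e.1 0).val := by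
  subst hvA hvB
  intro e he e' he'
  obtain ⟨a, ha, ha1, ha2⟩ := hA e he
  obtain ⟨b, hb, hb1, hb2⟩ := hB e' he'
  obtain ⟨hk1, hk2, hne⟩ := sep_of_time_ranges h1 h1' h2 h2' (a := a) (b := b) (by omega) (by omega) hb1 hb2
  refine ⟨fun h => hne ?_, by rw [ha, hb]; exact hk2, by rw [ha, hb]; exact hk1⟩
  rw [← ha, ← hb, h]

end Summit.QuantumFields.YangMills.Theorems.LatticeGapLargeBeta.WittenIMS

end
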